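import Summits.BirchSwinnertonDyer.Rank1Residual.Additive.TameBranchAnalyticShaLaw
import Summits.BirchSwinnertonDyer.Rank1Residual.Additive.TameBranchMuPartDefectTwoFullSqueeze
import HarnessLib

/-!
# THE ANALYTIC ORDER OF Ш IS THE CERTIFICATE — rank 0, X4♯(G-ord, `e = 2`) ∩ `I₀*` ∩ {`ρ̄` onto}:
# Kato 17.4 (3) + Delbourgo 2002 (A)(B) + GZK + modularity + **`p ∤ #Ш_an(E)`** (Cremona's column)
# ⟹ cc-typer-2's `TameBranchRatCharEqAt W p`, `Ш(E/ℚ)[p^∞] = 0`, `ℓ_p = 1`, `BSD(E,p)` and the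
# INTEGRAL main conjecture at the pair `char_Λ X(E/ℚ_∞) = (ι⁻¹(u·ϖ·B^±))` — NO `p`-adic certificate
# (cell `b2b-bsdres`, sub-cell additive-p2 = X3♯(G-ord)/X4♯(G-ord), gen 32; part 2)

HONEST FRAMING (cell `b2b-bsdres`, run/shared/lean/b2b/bsd-rank1-residual/, verbatim in every
file): the goal of the cell is to DELETE the COMBINATION-SHAPED residual classes of the
Birch–Swinnerton-Dyer formula for ALL analytic-rank `≤ 1` elliptic curves over `ℚ` — "full BSD
formula for every rank `≤ 1` curve in class `C`" assembled STRICTLY from published theorems — so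
that the rank-`≤ 1` remainder becomes exactly the CONSTRUCTION-SHAPED classes, which are TYPED
(missing-input `Prop`s), NOT attempted. This is not "finishing BSD". Sub-cell additive-p2: the
classes X3♯(G-ord) / X4♯(G-ord) are CONSTRUCTION-SHAPED and stay so; labels / RESIDUAL-MAP marks
UNCHANGED; nothing is booked (`BSD(E,p)` at rank 0 on these rows was ALREADY closed by gen 12 when
`p ∤ #Ш_an`; what is new is the Λ-adic statement). Theorems only; every published input is an explicit
named-fact binder: `hK` = the semistable big-image half-eigenspace reading of Kato 2004 Thm. 17.4 (3),
`hmodD` = BCDT modular parametrisations, `hDel` = Delbourgo 2002 (A)+(B) (A175), `hGZK` =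
Gross–Zagier–Kolyvagin, `hmod` = modularity. No definition, no named fact minted, no `sorry`.

## What and why

Gen 31 (`TameBranchMuPartDefectTwoFullSqueeze`) proved `TameBranchRatCharEqAt W p` + `#Ш[p^∞] = 1`
on X4♯(G-ord, `e = 2`) ∩ `I₀*` ∩ {`ρ̄` onto}, `p ≥ 5`, `r_an = 0`, from Kato 17.4 (3) + A175 + GZK +
modularity and TWO per-pair data: the first unit coefficient of `ϖ·B^±` at some index `n`, and the
inequality `v_p(ϖ·B^±(0)) + 2·ord_p #tors ≤ ord_p ∏c`. Part 1 of gen 32 (`TameBranchAnalyticShaLaw`)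
showed (i) the first-unit datum is superfluous (`fullSqueeze_rankZero_of_iota_eq`: the Kato element
GENERATES), and (ii) `v_p(ϖ·B^±(0)) + 2·ord_p #tors = ord_p #Ш_an(E) + ord_p ∏c` (Birch × Pal ×
Gauss × MTT, the tree's calibration `CensusX41.relationAt`). THIS FILE assembles the class level:

* `ClassX4Gord.charIdeal_eq_span_kato_of_shaAn_unit_rankZero` (§1, the core, per twist model /
  newform / period ratio and per cyclotomic datum): `ord_p #Ш_an(E) ≤ 0` ⟹ `X(E/ℚ_∞)` is torsion,
  `#Ш(E/ℚ)[p^∞] = 1`, `ord_p #Ш_an(E) = 0` (the upper half), and **`char_Λ X = (g)` for the Kato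
  element `g`, `ι g = u·ϖ·B^±_{(p−1)/2}(f♭, α)`, `u ∈ ℤ_p^×`** — Delbourgo's main conjecture (G) at the
  pair, INTEGRALLY in the E-normalisation — with `μ(X) = μ(g)`, `λ(X) = λ(g)` for every generator;
* **`ClassX4Gord.tameBranchRatCharEqAt_and_bsdp_of_katoHalf_of_shaAn_unit_rankZero`** (§2, the
  HEADLINE): X4♯(G-ord) ∩ `I₀*` ∩ {`ρ̄` onto}, `p ≥ 5`, `E` non-CM, `ord_{s=1} L(E,s) = 0`, and
  **`#Ш_an(E)` a rational of `p`-adic valuation `≤ 0`** ⟹ **`TameBranchRatCharEqAt W p`** (cc-typer-2's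
  typed rational main conjecture, "OUR CONJECTURE, OPEN on every cell"), **`#Ш(E/ℚ)[p^∞] = 1`**,
  **`ord_p #Ш_an(E) = 0`** and **`BSD(E,p)`** (`BSDp W p`) — from PRINT (Kato, Delbourgo (A)(B), GZK,
  BCDT/modularity) and ONE INTEGER of Cremona's table; no unit root, no branch value, no `(μ_an, λ_an)`
  column, no Tamagawa witness, no parity.

So on the defect-2 big-image rows at rank 0 the per-pair residual of the Λ-adic main conjecture is
EXACTLY the classical one of `BSD(E,p)`: `p ∤ #Ш_an(E)`. Where `p ∣ #Ш_an(E)` (census: 2900d1,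
10850m1, 16900k1, 19350cb1 at `p = 5`, `#Ш_an = 25`) neither this file nor gen 31 says anything —
that is where `BSD(E,p)` has content. What is NOT claimed: `BSD(E,p)` anywhere new (gen 12 had it on
these rows), defect 3, 4, 6, `p = 3`, rank 1 (part 3). Labels UNCHANGED.

References: Kato 2004 Thm. 17.4 (3) [Kato2004Asterisque]; Delbourgo 2002 Thm. (A), (B) p. 40
[Delbourgo2002]; Greenberg LNM 1716 §4 pp. 102–110 [GreenbergLNM1716]; Mazur–Tate–Teitelbaum 1986
§I.8, §I.13–I.14 [MazurTateTeitelbaum1986Invent]; Pal 2012 Thm. 3.2 [Pal2012]; Miller 2011 Def. 1.1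
[Miller2011LMS]; parts 1–4 of gen 31, part 1 of gen 32. -/

set_option autoImplicit false

noncomputable section

open scoped Classical MatrixGroups ModularForm NumberField

open CongruenceSubgroup IsDedekindDomain WeierstrassCurve NumberField
  Literature.NumberTheory.EllipticCurves
  Literature.NumberTheory.EllipticCurves.ModularForms
  Literature.NumberTheory.EllipticCurves.Rank1Residual
  Literature.NumberTheory.EllipticCurves.Rank1Residual.Typed
  Literature.NumberTheory.EllipticCurves.Delbourgo2002
  Literature.NumberTheory.GaloisRepresentations
  Summit.BirchSwinnertonDyer.Rank1Residual.AdditivePotMult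
  Summit.BirchSwinnertonDyer.Rank1Residual.X1.MuLambda
  Summit.BirchSwinnertonDyer.Rank1Residual.X1.RankOneParitySqueeze
  Summit.BirchSwinnertonDyer.Rank1Residual.X11a.LambdaNorm

namespace Summit.BirchSwinnertonDyer.Rank1Residual.Additive

/-! ### §0 Per datum: the squeeze is an EQUALITY at `T = 0` (`v_p(X(0)) + 2t = ord_p ∏c`) -/

namespace TameBranchAnalyticSha

open TameBranchExtraZeros

variable {W : WeierstrassCurve ℚ} [W.IsElliptic] {p : ℕ} [hp : Fact p.Prime]

/-- **The upper half at `T = 0`, analytic currency (per cyclotomic datum, rank 0).** For ANY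
`g ∈ char_Λ X` with `ι g = X`, `X(0) ≠ 0`: Delbourgo's clause 3 and `fE ∣ g` give
`ord_p #Ш[p^∞] + ord_p ∏c + ord_p ℓ ≤ v_p(X(0)) + 2·ord_p #E(ℚ)_tors` for Delbourgo's `ℓ ∣ p²`; in
particular **`ord_p ∏c ≤ v_p(X(0)) + 2·ord_p #tors`**, so the full-squeeze hypothesis of part 1 is in fact
an EQUALITY. (Gen 29's `schneider_and_padicVal_le_rankZero_of_iota_eq` on `B := ι(pfree g)`.)
[cite: Delbourgo2002, Theorem (B) (p. 40)] [cite: Washington1997, §7.1] -/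
theorem padicValNat_tamagawa_le_valuation_rankZero_of_iota_eq
    (hr0 : W.mordellWeilRank = 0) {Dh : PAdicHeightData W p} (hBcl : LeadingTermClauses W p Dh)
    {κ : ZpExtension ℚ p} {γ : Field.absoluteGaloisGroup ℚ}
    (hκ : κ.IsCyclotomic) (hγ : κ.IsTopGenerator γ) (hγ' : IsCyclotomicVariable p γ)
    (D : W.SelmerDualData κ γ) [Module.Finite (IwasawaAlgebra p) D.X] (hX : D.IsTorsion)
    {fE g : IwasawaAlgebra p} (hchar : D.charIdeal = Ideal.span {fE}) (hg : g ∈ D.charIdeal)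
    {X : PowerSeries ℚ_[p]} (hι : iwasawaToPowerSeries p g = X)
    (hX0 : PowerSeries.constantCoeff X ≠ 0) :
    Finite (AddCommGroup.primaryComponent W.sha p) ∧
      ∃ ℓ : ℕ, ℓ ∣ p ^ 2 ∧
        (padicValNat p (Nat.card (AddCommGroup.primaryComponent W.sha p)) : ℤ) +
            padicValNat p W.tamagawaProduct + padicValNat p ℓ ≤
          (PowerSeries.constantCoeff X).valuation + 2 * padicValNat p W.torsionOrder := by
  have hg0 : g ≠ 0 := by
    intro h0; apply hX0; rw [← hι, h0, map_zero, map_zero]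
  have hιB := iota_eq_C_pow_mu_mul_iota_pfree (p := p) g
  have hbd := norm_coeff_iota_pfree_le (p := p) g
  have hX0' : PowerSeries.coeff 0 X ≠ 0 := by rwa [PowerSeries.coeff_zero_eq_constantCoeff]
  obtain ⟨hB0, hvX⟩ := valuation_coeff_iota_eq_mu_add hι hX0'
  rw [PowerSeries.coeff_zero_eq_constantCoeff] at hB0 hvX
  have hμle : mu fE ≤ mu g := mu_le_mu_of_mem_span (by rw [← hchar]; exact hg) hg0
  have hμle' : (mu fE : ℤ) ≤ mu g := by exact_mod_cast hμle
  obtain ⟨-, hfin, ℓ, hℓp, -, hle, -⟩ :=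
    schneider_and_padicVal_le_rankZero_of_iota_eq hr0 hBcl hκ hγ hγ' D hX hchar hg hιB hbd hB0
  haveI : Finite W.toAffine.Point := W.mordellWeilRank_eq_zero_iff_finite.mp hr0
  have hReg : (padicRegulator Dh).valuation = 0 := by
    rw [padicRegulator_eq_one_of_finite W p Dh, Padic.valuation_one]
  rw [hReg] at hle
  refine ⟨hfin, ℓ, hℓp, ?_⟩
  rw [hvX]
  simp only [Nat.cast_zero, add_zero] at hle
  linarith

end TameBranchAnalyticSha

/-! ### §1 The core on X4♯(G-ord, `e = 2`) ∩ `I₀*` ∩ {`ρ̄` onto}: `char_Λ X = (Kato element)` -/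

section Core

open TameBranchMuPart TameBranchAnalyticSha

variable {W : WeierstrassCurve ℚ} [W.IsElliptic] [W.IsGloballyMinimal] {p : ℕ} [hp : Fact p.Prime]

/-- **THE CORE: `p ∤ #Ш_an(E)` ⟹ THE KATO ELEMENT GENERATES `char_Λ X(E/ℚ_∞)`.** X4♯(G-ord) ∩ `I₀*`
∩ {`ρ̄_{E,p}` onto}, `p ≥ 5`, `E = W` non-CM with `ord_{s=1} L(E,s) = 0`; `V = E♭` globally minimal,
good ordinary at `p`, `C • V^{(p*)} = W`, `f` a newform of `V`, `ϖ` the period ratio of the parity of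
`(p−1)/2`; Miller's `#Ш_an(E) = shaAn W` a rational `s` with **`ord_p s ≤ 0`**. Then for every
cyclotomic dual datum `D` of `Sel_{p^∞}(E/ℚ_∞)`: `X` is `Λ`-torsion, **`#Ш(E/ℚ)[p^∞] = 1`**,
**`ord_p s = 0`**, and there is a Kato element `g` with **`char_Λ X = (g)`** and
**`ι g = u·ϖ·B^±_{(p−1)/2}(f, α)`**, `u ∈ ℤ_p^×` — Delbourgo's main conjecture (G) at the pair,
INTEGRALLY in the E-normalisation — every generator `fE` having `μ(fE) = μ(g)`, `λ(fE) = λ(g)`.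
Inputs: Kato 17.4 (3) (`hK`), Delbourgo 2002 (A)(B) (`hDel`), GZK, modularity; part 1 §1–§2.
[cite: Kato2004Asterisque, Thm. 17.4 (3) (p. 273)] [cite: Delbourgo2002, Theorem (A), (B) (p. 40)]
[cite: GreenbergLNM1716, §4 pp. 102–110] [cite: MazurTateTeitelbaum1986Invent, §I.8 (8.6), §I.13–I.14] -/
theorem ClassX4Gord.charIdeal_eq_span_kato_of_shaAn_unit_rankZero
    (hK : Wuthrich2014.kato_halfEigenCharIdeal_dvd_cyclotomicPrime_of_surjective)
    (hDel : Delbourgo2002.mainTheorem) (hGZK : rank_eq_analyticRank_of_analyticRank_le_one)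
    (hmod : hasEntireLFunction_rat)
    (hX : ClassX4Gord W p) (hp5 : 5 ≤ p) (hcm : ¬ W.HasCM) (hsurj : Surj W p)
    (hr : W.analyticRank = 0) {s : ℚ} (hs : shaAn W = (s : ℂ)) (hsv : padicValRat p s ≤ 0)
    (V : WeierstrassCurve ℚ) [V.IsElliptic] [V.IsGloballyMinimal] (C : VariableChange ℚ)
    (hC : C • V.quadraticTwist ((-1 : ℚ) ^ (p / 2) * p) = W) (hV : GoodOrd V p)
    {N : ℕ} [NeZero N] {f : CuspForm (Gamma0 N) 2} (hf : IsNewformOf V f)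
    (ϖ : ℚ) (hϖ : if Even (p / 2) then (ϖ : ℝ) * V.realPeriodRat = plusPeriod f
      else (ϖ : ℝ) * V.imaginaryPeriodRat = minusPeriod f)
    {κ : ZpExtension ℚ p} {γ : Field.absoluteGaloisGroup ℚ}
    (hκ : κ.IsCyclotomic) (hγ : κ.IsTopGenerator γ) (hγ' : IsCyclotomicVariable p γ)
    (D : W.SelmerDualData κ γ) :
    D.IsTorsion ∧ Nat.card (AddCommGroup.primaryComponent W.sha p) = 1 ∧ padicValRat p s = 0 ∧
      ∃ (g : IwasawaAlgebra p) (u : ℤ_[p]ˣ), D.charIdeal = Ideal.span {g} ∧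
        iwasawaToPowerSeries p g =
          PowerSeries.C (((u : ℤ_[p]) : ℚ_[p]) * (ϖ : ℚ_[p])) *
            (if Even (p / 2) then padicLFunctionBranch f ((unitRoot V p : ℤ_[p]) : ℚ_[p]) (p / 2)
              else padicLFunctionMinusBranch f ((unitRoot V p : ℤ_[p]) : ℚ_[p]) (p / 2)) ∧
        ∀ fE : IwasawaAlgebra p, D.charIdeal = Ideal.span {fE} → mu fE = mu g ∧ lam fE = lam g := by
  have hp2 : p ≠ 2 := by omega
  have hadd : Addv W p := hX.addv.2
  obtain ⟨hmw, -⟩ := hGZK W (by rw [hr]; norm_num)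
  have hr0 : W.mordellWeilRank = 0 := by rw [hmw, hr]
  have hL : W.entireLFunction 1 ≠ 0 := (W.analyticRank_eq_zero_iff_holds (hmod W)).mp hr
  have hΩ : (W.realPeriodRat : ℂ) ≠ 0 := by exact_mod_cast W.realPeriodRat_pos_holds.ne'
  obtain ⟨Dh, hBcl⟩ := Delbourgo2002.mainTheorem.exists_leadingTermClauses hDel hp5 hcm hadd hX.typeGOrd
  have hj := padicValRat_j_nonneg_of_typeGOrd W p hX.typeGOrd
  have hsurjV : ∀ m : ℕ, V.HasSurjectiveModNGaloisRep (p ^ m : ℕ) :=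
    X4RankZeroTwistOdd.forall_surj_pow_twist_of_surj W p hp5 V (pStar_ne_zero p) C hC hsurj
  have hord : IsOrdinaryAt V p :=
    isOrdinaryAt_of_goodOrd_or_mult_of_model_twist W V (pStar_ne_zero p) ⟨C, hC⟩ hj (Or.inl hV)
  haveI : Module.Finite (IwasawaAlgebra p) D.X :=
    SelmerDualData.module_finite_of_isCyclotomic (W := W) (κ := κ) hκ D hγ
  -- Kato's element on the tame branch
  obtain ⟨hXt, g, hg, u, hι⟩ := isTorsion_and_exists_iota_eq_branch_of_katoComponent W p
    (Kato2004.charIdeal_dvd_padicLFunctionBranch_component_of_surjective_of_half hK) hj hp2 V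
    ⟨C, hC⟩ (Or.inl hV) hsurjV hκ hγ hγ' hf D ϖ hϖ
  -- the dictionary at `T = 0`: `(ϖB)(0) = u'·(L(E,1)/Ω_E)`, `v_p((ϖB)(0)) + 2t = ord_p s + ord_p ∏c`
  obtain ⟨q, u', hu'0, -, hLq, hA⟩ :=
    exists_rat_and_unit_constantCoeff_branch_eq hmod hp2 hadd V C hC hord hf ϖ hϖ
  have hdict :=
    valuation_constantCoeff_branch_add_eq_padicValRat_shaAn_add hmod hGZK hp2 hadd hL V C hC hord hf ϖ hϖ hs
  have hq0 : q ≠ 0 := by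
    intro h0
    apply hL
    have e : W.entireLFunction 1 = (q : ℂ) * (W.realPeriodRat : ℂ) := by
      rw [← hLq, div_mul_cancel₀ _ hΩ]
    rw [e, h0, Rat.cast_zero, zero_mul]
  have hϖB0 : PowerSeries.constantCoeff (PowerSeries.C (ϖ : ℚ_[p]) *
      (if Even (p / 2) then padicLFunctionBranch f ((unitRoot V p : ℤ_[p]) : ℚ_[p]) (p / 2)
        else padicLFunctionMinusBranch f ((unitRoot V p : ℤ_[p]) : ℚ_[p]) (p / 2))) ≠ 0 := by
    rw [hA]; exact mul_ne_zero hu'0 (by exact_mod_cast hq0)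
  have hX0eq : PowerSeries.constantCoeff (PowerSeries.C (((u : ℤ_[p]) : ℚ_[p]) * (ϖ : ℚ_[p])) *
      (if Even (p / 2) then padicLFunctionBranch f ((unitRoot V p : ℤ_[p]) : ℚ_[p]) (p / 2)
        else padicLFunctionMinusBranch f ((unitRoot V p : ℤ_[p]) : ℚ_[p]) (p / 2))) =
      ((u : ℤ_[p]) : ℚ_[p]) * PowerSeries.constantCoeff (PowerSeries.C (ϖ : ℚ_[p]) *
        (if Even (p / 2) then padicLFunctionBranch f ((unitRoot V p : ℤ_[p]) : ℚ_[p]) (p / 2)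
          else padicLFunctionMinusBranch f ((unitRoot V p : ℤ_[p]) : ℚ_[p]) (p / 2))) := by
    simp only [map_mul, PowerSeries.constantCoeff_C]
    ring
  have hX0 : PowerSeries.constantCoeff (PowerSeries.C (((u : ℤ_[p]) : ℚ_[p]) * (ϖ : ℚ_[p])) *
      (if Even (p / 2) then padicLFunctionBranch f ((unitRoot V p : ℤ_[p]) : ℚ_[p]) (p / 2)
        else padicLFunctionMinusBranch f ((unitRoot V p : ℤ_[p]) : ℚ_[p]) (p / 2))) ≠ 0 := by
    rw [hX0eq]; exact mul_ne_zero (coe_units_ne_zero p u) hϖB0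
  have hvX : (PowerSeries.constantCoeff (PowerSeries.C (((u : ℤ_[p]) : ℚ_[p]) * (ϖ : ℚ_[p])) *
      (if Even (p / 2) then padicLFunctionBranch f ((unitRoot V p : ℤ_[p]) : ℚ_[p]) (p / 2)
        else padicLFunctionMinusBranch f ((unitRoot V p : ℤ_[p]) : ℚ_[p]) (p / 2)))).valuation +
        2 * padicValNat p W.torsionOrder = padicValRat p s + padicValNat p W.tamagawaProduct := by
    rw [hX0eq, Padic.valuation_mul (coe_units_ne_zero p u) hϖB0, valuation_coe_units_eq_zero, zero_add,
      hdict]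
  -- a generator, the squeeze, the upper half
  haveI : (Literature.NumberTheory.EllipticCurves.Module.charIdeal (IwasawaAlgebra p) D.X).IsPrincipal :=
    charIdeal_isPrincipal_holds p D.X
  obtain ⟨fE, hchar⟩ := Submodule.IsPrincipal.principal
    (Literature.NumberTheory.EllipticCurves.Module.charIdeal (IwasawaAlgebra p) D.X)
  obtain ⟨hspan, -, -, hcard, -, -⟩ := fullSqueeze_rankZero_of_iota_eq hp2 hr0 hBcl hκ hγ hγ' D hXt
    hchar hg hι hX0 (by linarith)
  obtain ⟨-, ℓ, -, hle⟩ := padicValNat_tamagawa_le_valuation_rankZero_of_iota_eq hr0 hBcl hκ hγ hγ' D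
    hXt hchar hg hι hX0
  have hs0 : padicValRat p s = 0 := by
    have h1 : (0 : ℤ) ≤ padicValNat p (Nat.card (AddCommGroup.primaryComponent W.sha p)) := by
      exact_mod_cast Nat.zero_le _
    have h2 : (0 : ℤ) ≤ padicValNat p ℓ := by exact_mod_cast Nat.zero_le _
    linarith
  refine ⟨hXt, hcard, hs0, g, u, hspan, hι, fun fE' hchar' ↦ ?_⟩
  obtain ⟨-, hμ, hlam, -⟩ := fullSqueeze_rankZero_of_iota_eq hp2 hr0 hBcl hκ hγ hγ' D hXt hchar' hg hι
    hX0 (by linarith)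
  exact ⟨hμ, hlam⟩

end Core

/-! ### §2 The headline: `p ∤ #Ш_an(E)` ⟹ `TameBranchRatCharEqAt W p` ∧ `Ш[p^∞] = 0` ∧ `BSD(E,p)` -/

section Headline

open TameBranchMuPart TameBranchAnalyticSha

variable {W : WeierstrassCurve ℚ} [W.IsElliptic] [W.IsGloballyMinimal] {p : ℕ} [hp : Fact p.Prime]

/-- **HEADLINE, RANK ZERO: THE ANALYTIC ORDER OF Ш IS THE CERTIFICATE.** X4♯(G-ord) ∩ `I₀*` ∩
{`ρ̄_{E,p}` onto}, `p ≥ 5`, `E` non-CM, `ord_{s=1} L(E,s) = 0`, and Miller's analytic order of `Ш`,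
`#Ш_an(E) = L(E,1)·#E(ℚ)²_tors/(Ω_E·∏c_ℓ)`, a rational number with **`ord_p #Ш_an(E) ≤ 0`**. Then
**`TameBranchRatCharEqAt W p`** — cc-typer-2's typed RATIONAL MAIN CONJECTURE on the tame branch
("OUR CONJECTURE, OPEN on every cell", `TameBranchLower.lean`) —, **`#Ш(E/ℚ)[p^∞] = 1`**,
**`ord_p #Ш_an(E) = 0`** and **Miller's `BSD(E,p)`**. Inputs: Kato 2004 Thm. 17.4 (3) (`hK`), BCDT
(`hmodD`), Delbourgo 2002 (A)(B) (`hDel`), Gross–Zagier–Kolyvagin (`hGZK`), modularity (`hmod`) — and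
ONE INTEGER from Cremona's table. No unit root, no branch value, no `(μ_an, λ_an)` column, no Tamagawa
witness, no parity: on these rows the per-pair residual of the Λ-adic main conjecture IS the classical
residual `p ∤ #Ш_an` of `BSD(E,p)`. [cite: Kato2004Asterisque, Thm. 17.4 (3) (p. 273)]
[cite: Delbourgo2002, Theorem (A), (B) (p. 40)] [cite: GreenbergLNM1716, §4 pp. 102–110]
[cite: MazurTateTeitelbaum1986Invent, §I.8 (8.6), §I.13–I.14] [cite: Pal2012, Thm. 3.2]
[cite: Miller2011LMS, Def. 1.1 (arXiv:1010.2431 p. 3)] -/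
theorem ClassX4Gord.tameBranchRatCharEqAt_and_bsdp_of_katoHalf_of_shaAn_unit_rankZero
    (hK : Wuthrich2014.kato_halfEigenCharIdeal_dvd_cyclotomicPrime_of_surjective)
    (hmodD : nonempty_modularParametrizationData) (hDel : Delbourgo2002.mainTheorem)
    (hGZK : rank_eq_analyticRank_of_analyticRank_le_one) (hmod : hasEntireLFunction_rat)
    (hX : ClassX4Gord W p) (hp5 : 5 ≤ p) (hcm : ¬ W.HasCM) (he : semistabilityIndex W p = 2)
    (hsurj : Surj W p) (hr : W.analyticRank = 0)
    {s : ℚ} (hs : shaAn W = (s : ℂ)) (hsv : padicValRat p s ≤ 0) :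
    TameBranchRatCharEqAt W p ∧ Nat.card (AddCommGroup.primaryComponent W.sha p) = 1 ∧
      padicValRat p s = 0 ∧ BSDp W p := by
  have hp2 : p ≠ 2 := by omega
  obtain ⟨hmw, -⟩ := hGZK W (by rw [hr]; norm_num)
  have hL : W.entireLFunction 1 ≠ 0 := (W.analyticRank_eq_zero_iff_holds (hmod W)).mp hr
  obtain ⟨V, iV, iVm, C, hV, hC⟩ := hX.exists_goodOrd_pStar_twist_model W p he
  haveI : NeZero (V.conductorNorm ℤ) := ⟨(V.conductorNorm_pos_holds).ne'⟩
  obtain ⟨Dm⟩ := hmodD V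
  obtain ⟨ϖ, hϖ⟩ := exists_periodRatio_parity (p := p) V Dm
  have core := fun {κ : ZpExtension ℚ p} {γ : Field.absoluteGaloisGroup ℚ} (hκ : κ.IsCyclotomic)
      (hγ : κ.IsTopGenerator γ) (hγ' : IsCyclotomicVariable p γ) (D : W.SelmerDualData κ γ) ↦
    hX.charIdeal_eq_span_kato_of_shaAn_unit_rankZero hK hDel hGZK hmod hp5 hcm hsurj hr hs hsv V C hC hV
      Dm.isNewformOf ϖ hϖ hκ hγ hγ' D
  -- one cyclotomic datum exists: read off `#Ш[p^∞] = 1` and `ord_p s = 0`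
  obtain ⟨κ₀, γ₀, hκ₀, hγ₀, hγ₀', D₀, -, -⟩ := exists_cyclotomic_dualData_generator W p
  obtain ⟨-, hcard, hs0, -⟩ := core hκ₀ hγ₀ hγ₀' D₀
  -- the Néron-normalised branch has non-zero constant term (`L(E,1) ≠ 0`): `ϖ ≠ 0`, `B^± ≠ 0`
  have hΩ : (W.realPeriodRat : ℂ) ≠ 0 := by exact_mod_cast W.realPeriodRat_pos_holds.ne'
  have hj := padicValRat_j_nonneg_of_typeGOrd W p hX.typeGOrd
  have hord : IsOrdinaryAt V p :=
    isOrdinaryAt_of_goodOrd_or_mult_of_model_twist W V (pStar_ne_zero p) ⟨C, hC⟩ hj (Or.inl hV)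
  obtain ⟨q, u', hu'0, -, hLq, hA⟩ :=
    exists_rat_and_unit_constantCoeff_branch_eq hmod hp2 hX.addv.2 V C hC hord Dm.isNewformOf ϖ hϖ
  have hq0 : q ≠ 0 := by
    intro h0
    apply hL
    have e : W.entireLFunction 1 = (q : ℂ) * (W.realPeriodRat : ℂ) := by
      rw [← hLq, div_mul_cancel₀ _ hΩ]
    rw [e, h0, Rat.cast_zero, zero_mul]
  have h0 : PowerSeries.constantCoeff (PowerSeries.C (ϖ : ℚ_[p]) *
      (if Even (p / 2) then padicLFunctionBranch Dm.f ((unitRoot V p : ℤ_[p]) : ℚ_[p]) (p / 2)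
        else padicLFunctionMinusBranch Dm.f ((unitRoot V p : ℤ_[p]) : ℚ_[p]) (p / 2))) ≠ 0 := by
    rw [hA]; exact mul_ne_zero hu'0 (by exact_mod_cast hq0)
  have hϖ0 : ϖ ≠ 0 := by
    rintro rfl
    apply h0
    rw [Rat.cast_zero, map_zero, zero_mul, map_zero]
  have hB0 : (if Even (p / 2) then padicLFunctionBranch Dm.f ((unitRoot V p : ℤ_[p]) : ℚ_[p]) (p / 2)
      else padicLFunctionMinusBranch Dm.f ((unitRoot V p : ℤ_[p]) : ℚ_[p]) (p / 2)) ≠ 0 := by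
    intro e; apply h0; rw [e, mul_zero, map_zero]
  refine ⟨?_, hcard, hs0, ⟨hmw, Nat.finite_of_card_ne_zero (by rw [hcard]; exact one_ne_zero), s, hs,
    by rw [hs0, hcard, padicValNat_one_right, Nat.cast_zero]⟩⟩
  intro κ γ N _ f ε α B _ haddv _ hκ hγ hcv hf _ hα hB D
  obtain ⟨hXt, -, -, g₁, u, hspan, hι, -⟩ := core hκ hγ hcv D
  -- `E`'s plus symbol is not identically zero: `[0]⁺_f ≠ 0` from `L(E,1) ≠ 0`
  have hnd : ∃ r : ℚ, ratPlusSymbol f r ≠ 0 := by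
    refine ⟨0, fun h00 ↦ hL ?_⟩
    rw [hf.entireLFunction_one_eq, h00]
    simp
  exact ⟨hXt, exists_charIdeal_eq_span_and_iota_eq_of_generator hp2 V C hC haddv hV hf hnd Dm hϖ0
    hspan hι hB0 hα hB⟩

end Headline

end Summit.BirchSwinnertonDyer.Rank1Residual.Additive

end
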